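import Summits.QuantumFields.YangMills.Theorems.EquipartitionCriticalityEquipartitionPinsProbeTangentEnergyAlgebra
import Summits.QuantumFields.YangMills.Theorems.EquipartitionCriticalityEquipartitionPinsProbeTangentFieldMoments
import Summits.QuantumFields.YangMills.Theorems.EquipartitionCriticalityEquipartitionPinsProbeTangentPlaqFieldContinuous
import Summits.QuantumFields.YangMills.Theorems.EquipartitionCriticalityEquipartitionPinsProbeTangentDiffIdentity
import Summits.QuantumFields.YangMills.Theorems.EquipartitionCriticalityEquipartitionPinsProbeTangentHaarShiftLimit
import Summits.QuantumFields.YangMills.Theorems.EquipartitionCriticalityEquipartitionPinsProbeTangentCombShift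
import Mathlib.Analysis.Calculus.FDeriv.Measurable
import Mathlib.Analysis.Calculus.MeanValue
import Mathlib.Analysis.Calculus.Deriv.Shift
import Mathlib.Analysis.SpecialFunctions.Exponential
import Mathlib.Analysis.SpecialFunctions.Trigonometric.Bounds
import Mathlib.Analysis.Normed.Algebra.MatrixExponential
import HarnessLib

/-!
# Finite-`β` Stein identity, part 1: preliminaries (crux `stmt-QuantumFields-8760`, line `Sketch`, STUB TS7)

Route `EquipartitionCriticality` of `YangMills`, crux `EquipartitionPinsProbe`, line `Sketch`, stub
`stub_steinFiniteBeta` (TS7: the differentiated one-link skew Haar-shift identity at finite `β`). This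
file: the one-parameter subgroups `k` of `G` with `ρ(k(t)) = exp(t e_b)` (existence from `stub_lieFrame`,
homomorphism and continuity from faithfulness of `ρ`), small real-analysis helpers (AM–GM form of the
error bound, a Lipschitz bound for `exp` on a half-line, boundedness of continuous functions on a compact
space), flow lemmas (derivatives at every time and Lipschitz bounds along a flow `T_{t+s} = T_t ∘ T_s`,
measurability of parameter derivatives via `measurable_deriv_with_param`), the two one-link shift
families in the comb gauge (left: `U_e ↦ G_U(x)⁻¹ k(t) G_U(x) U_e`; right:
`U_e ↦ U_e G_U(x+eᵢ)⁻¹ k(t)⁻¹ G_U(x+eᵢ)`; they are flows as soon as the transport does not read the link,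
STUB TS0 `stub_combShift`), and the cylinder property of the conjugated shift elements and of the
trigonometric test observables. Reference: S. Chatterjee, arXiv:1602.01222 §§9–11. [arXiv160201222]
-/

noncomputable section

open MeasureTheory Filter Topology
open scoped Matrix Matrix.Norms.Frobenius
open Literature.Probability.LatticeModels Literature.MathematicalPhysics.QuantumLattice
open Literature.MathematicalPhysics.QuantumFieldTheory hiding ZdEdge IsLocalObservable IsInfiniteVolumeLimit

namespace Summit.QuantumFields.YangMills.Theorems.EquipartitionPinsProbe

namespace TangentSteinFiniteBeta

/-! ### One-parameter subgroups of `G` over the Lie frame -/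

section OneParam

variable {G : Type} [Group G] [TopologicalSpace G] (r : LatticeRep G)

/-- There is `k : ℝ → G` with `ρ(k(t)) = exp(t e_b)` (`e_b` generates a one-parameter subgroup of
`ρ(G)`, `stub_lieFrame`). -/
theorem exists_oneParam [CompactSpace G] (b : Fin (lieDim r)) :
    ∃ k : ℝ → G, ∀ t : ℝ, r.ρ (k t) = NormedSpace.exp ((t : ℂ) • lieVec r b) :=
  ⟨fun t => Classical.choose ((stub_lieFrame G r).2.2.1 b t),
    fun t => Classical.choose_spec ((stub_lieFrame G r).2.2.1 b t)⟩

variable {r} {b : Fin (lieDim r)} {k : ℝ → G}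

/-- `k(0) = 1`. -/
theorem oneParam_zero (hk : ∀ t : ℝ, r.ρ (k t) = NormedSpace.exp ((t : ℂ) • lieVec r b)) : k 0 = 1 :=
  r.injective (by rw [hk, map_one, Complex.ofReal_zero, zero_smul, NormedSpace.exp_zero])

/-- `k(s + t) = k(s) k(t)`. -/
theorem oneParam_add (hk : ∀ t : ℝ, r.ρ (k t) = NormedSpace.exp ((t : ℂ) • lieVec r b)) (s t : ℝ) :
    k (s + t) = k s * k t := by
  refine r.injective ?_
  rw [map_mul, hk, hk, hk, Complex.ofReal_add, add_smul]
  exact NormedSpace.exp_add_of_commute (((Commute.refl (lieVec r b)).smul_left _).smul_right _)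

/-- `k(-t) = k(t)⁻¹`. -/
theorem oneParam_neg (hk : ∀ t : ℝ, r.ρ (k t) = NormedSpace.exp ((t : ℂ) • lieVec r b)) (t : ℝ) :
    k (-t) = (k t)⁻¹ := by
  refine eq_inv_of_mul_eq_one_left ?_
  rw [← oneParam_add hk, neg_add_cancel, oneParam_zero hk]

/-- `k` is continuous (`ρ` is a closed embedding of the compact group `G` into the matrices and
`t ↦ exp(t e_b)` is continuous). -/
theorem continuous_oneParam [CompactSpace G] (hk : ∀ t : ℝ, r.ρ (k t) = NormedSpace.exp ((t : ℂ) • lieVec r b)) :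
    Continuous k := by
  have hemb := (r.continuous.isClosedEmbedding r.injective).isEmbedding
  rw [hemb.continuous_iff]
  have : r.ρ ∘ k = fun t : ℝ => NormedSpace.exp ((t : ℂ) • lieVec r b) := funext fun t => hk t
  rw [this]
  exact NormedSpace.exp_continuous.comp (Complex.continuous_ofReal.smul continuous_const)

end OneParam

/-! ### Small helpers -/

section Helpers

variable {G : Type} [Group G]

/-- The incidence number `[p : e] = (dδ_e)(p)` vanishes unless `p` touches `e`. -/
theorem curl_indicator_eq_zero {e : Literature.MathematicalPhysics.QuantumLattice.ZdEdge 4} {p : ZdPlaquette 4}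
    (hp : p ∉ plaquettesTouching ({e} : Finset (Literature.MathematicalPhysics.QuantumLattice.ZdEdge 4))) :
    plaquetteCurl (fun e' => if e' = e then (1 : ℝ) else 0) p = 0 := by
  have hne : ∀ i : Fin 4, plaquetteBoundary p i ≠ e := by
    intro i hi
    apply hp
    rw [mem_plaquettesTouching_iff]
    refine ⟨e, Finset.mem_inter.2 ⟨?_, Finset.mem_singleton_self e⟩⟩
    rw [← image_plaquetteBoundary, Finset.mem_image]
    exact ⟨i, Finset.mem_univ _, hi⟩
  simp only [plaquetteCurl, hne, if_false, mul_zero, Finset.sum_const_zero]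

/-- `|[p : e]| ≤ 4`. -/
theorem abs_curl_indicator_le (e : Literature.MathematicalPhysics.QuantumLattice.ZdEdge 4) (p : ZdPlaquette 4) :
    |plaquetteCurl (fun e' => if e' = e then (1 : ℝ) else 0) p| ≤ 4 := by
  unfold plaquetteCurl
  refine (Finset.abs_sum_le_sum_abs _ _).trans ?_
  have h4 : (4 : ℝ) = ∑ _i : Fin 4, (1 : ℝ) := by simp
  rw [h4]
  refine Finset.sum_le_sum fun i _ => ?_
  have hs : |plaquetteBoundarySign i| = 1 := by
    fin_cases i <;> simp [plaquetteBoundarySign]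
  rw [abs_mul, hs, one_mul]
  dsimp only
  split_ifs <;> simp

/-- Sums against `dδ_e` over `S ⊇ plaquettesTouching {e}` reduce to the plaquettes touching `e`. -/
theorem sum_curl_indicator_subset {e : Literature.MathematicalPhysics.QuantumLattice.ZdEdge 4} {S : Finset (ZdPlaquette 4)}
    (hS : plaquettesTouching ({e} : Finset (Literature.MathematicalPhysics.QuantumLattice.ZdEdge 4)) ⊆ S) (f : ZdPlaquette 4 → ℝ) :
    ∑ p ∈ S, plaquetteCurl (fun e' => if e' = e then (1 : ℝ) else 0) p * f p =
      ∑ p ∈ plaquettesTouching ({e} : Finset (Literature.MathematicalPhysics.QuantumLattice.ZdEdge 4)),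
        plaquetteCurl (fun e' => if e' = e then (1 : ℝ) else 0) p * f p :=
  (Finset.sum_subset hS fun p _ hp => by rw [curl_indicator_eq_zero hp, zero_mul]).symm

/-- AM–GM in the form used for the error terms: `|x| ≤ θ/2 + x²/(2θ)`. -/
theorem abs_le_amgm {θ : ℝ} (hθ : 0 < θ) (x : ℝ) : |x| ≤ θ / 2 + x ^ 2 / (2 * θ) := by
  have h : 0 ≤ (|x| - θ) ^ 2 := sq_nonneg _
  have hx2 : |x| ^ 2 = x ^ 2 := sq_abs x
  rw [div_add_div _ _ (two_ne_zero) (by positivity), le_div_iff₀ (by positivity)]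
  nlinarith [hx2, h, abs_nonneg x, hθ]

/-- `exp` is `e^M`-Lipschitz on `(-∞, M]`. -/
theorem abs_exp_sub_exp_le {x y M : ℝ} (hx : x ≤ M) (hy : y ≤ M) :
    |Real.exp x - Real.exp y| ≤ Real.exp M * |x - y| := by
  wlog hxy : y ≤ x generalizing x y
  · rw [abs_sub_comm, abs_sub_comm x y]
    exact this hy hx (le_of_not_ge hxy)
  have h1 : Real.exp x - Real.exp y ≤ Real.exp x * (x - y) := by
    have := Real.add_one_le_exp (y - x)
    have hpos := Real.exp_pos x
    have : Real.exp y = Real.exp x * Real.exp (y - x) := by rw [← Real.exp_add]; ring_nf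
    nlinarith [Real.add_one_le_exp (y - x)]
  rw [abs_of_nonneg (sub_nonneg.2 (Real.exp_le_exp.2 hxy)), abs_of_nonneg (sub_nonneg.2 hxy)]
  exact h1.trans (mul_le_mul_of_nonneg_right (Real.exp_le_exp.2 hx) (sub_nonneg.2 hxy))

omit [Group G] in
/-- A continuous real function on a compact space is bounded (with a non-negative bound). -/
theorem exists_abs_le_of_continuous {X : Type} [TopologicalSpace X] [CompactSpace X] {f : X → ℝ} (hf : Continuous f) :
    ∃ C : ℝ, 0 ≤ C ∧ ∀ U, |f U| ≤ C := by
  obtain ⟨C, hC⟩ := isCompact_univ.exists_bound_of_continuousOn hf.continuousOn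
  exact ⟨max C 0, le_max_right _ _, fun U => (by simpa [Real.norm_eq_abs] using hC U (Set.mem_univ U) :
    |f U| ≤ C).trans (le_max_left _ _)⟩

end Helpers

/-! ### Flows: derivatives everywhere, Lipschitz bounds, measurability of parameter derivatives -/

section Flow

variable {X : Type}

/-- Along a flow `T_{t+s} = T_t ∘ T_s`, a derivative at `0` for every starting point gives the
derivative at every time. -/
theorem hasDerivAt_of_flow (T : ℝ → X → X) (hflow : ∀ s t U, T (t + s) U = T t (T s U))
    (φ : X → ℝ) (d : X → ℝ) (hd : ∀ U, HasDerivAt (fun t => φ (T t U)) (d U) 0) (s : ℝ) (U : X) :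
    HasDerivAt (fun t => φ (T t U)) (d (T s U)) s := by
  have h2 : (fun t => φ (T t U)) = fun t => φ (T (t - s) (T s U)) := by
    funext t; rw [← hflow, sub_add_cancel]
  rw [h2]
  have h3 : HasDerivAt (fun t => φ (T t (T s U))) (d (T s U)) (s - s) := by
    rw [sub_self]; exact hd (T s U)
  exact h3.comp_sub_const s s

/-- Along a flow, a uniformly bounded derivative at `0` makes `t ↦ φ(T_t U)` Lipschitz. -/
theorem lipschitz_of_flow (T : ℝ → X → X) (hflow : ∀ s t U, T (t + s) U = T t (T s U))
    (φ : X → ℝ) (d : X → ℝ) (hd : ∀ U, HasDerivAt (fun t => φ (T t U)) (d U) 0) {C : ℝ}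
    (hC : ∀ U, |d U| ≤ C) (U : X) (t s : ℝ) : |φ (T t U) - φ (T s U)| ≤ C * |t - s| := by
  have h := Convex.norm_image_sub_le_of_norm_hasDerivWithin_le (f := fun t => φ (T t U))
    (f' := fun t => d (T t U)) (s := Set.univ) (x := s) (y := t)
    (fun x _ => (hasDerivAt_of_flow T hflow φ d hd x U).hasDerivWithinAt)
    (fun x _ => by rw [Real.norm_eq_abs]; exact hC _) convex_univ (Set.mem_univ _) (Set.mem_univ _)
  simpa only [Real.norm_eq_abs] using h

/-- The parameter derivative at `0` of a jointly continuous family is measurable in the state. -/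
theorem measurable_deriv_param [TopologicalSpace X] [MeasurableSpace X] [OpensMeasurableSpace X] (f : ℝ → X → ℝ) (hf : Continuous fun q : ℝ × X => f q.1 q.2) :
    Measurable fun U => deriv (fun t => f t U) 0 := by
  have hf' : Continuous (Function.uncurry fun (U : X) (t : ℝ) => f t U) :=
    hf.comp (continuous_snd.prodMk continuous_fst)
  exact (measurable_deriv_with_param hf').comp (measurable_id.prodMk measurable_const)

/-- A jointly continuous family is continuous in the state at each fixed time. -/
theorem continuous_slice [TopologicalSpace X] (T : ℝ → X → X) (hTc : Continuous fun q : ℝ × X => T q.1 q.2) (t : ℝ) :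
    Continuous fun U => T t U :=
  hTc.comp (continuous_const.prodMk continuous_id)

end Flow

/-! ### The two one-link shift families in the comb gauge -/

section Families

variable {G : Type} [Group G] [TopologicalSpace G] [IsTopologicalGroup G] [CompactSpace G] {r : LatticeRep G}
  {b : Fin (lieDim r)} {k : ℝ → G}

/-- **The left family** `T_t U = U[e ↦ G_U(x)⁻¹ k(t) G_U(x) U_e]` (`x = e.1`): it starts at the
identity, is a flow as soon as the transport `G_U(x)` does not read the link `e`, is jointly
continuous, and its inverse shift is `T_{-t}`. -/
theorem leftFamily (hk : ∀ t : ℝ, r.ρ (k t) = NormedSpace.exp ((t : ℂ) • lieVec r b))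
    (e : Literature.MathematicalPhysics.QuantumLattice.ZdEdge 4)
    (hinv : ∀ (U : LGConfig 4 G) (g : G), combTransport (Function.update U e g) e.1 = combTransport U e.1) :
    ∃ T : ℝ → LGConfig 4 G → LGConfig 4 G,
      (∀ (t : ℝ) (U : LGConfig 4 G), T t U = Function.update U e ((combTransport U e.1)⁻¹ * k t * combTransport U e.1 * U e)) ∧
      (∀ U, T 0 U = U) ∧ (∀ s t U, T (t + s) U = T t (T s U)) ∧ (Continuous fun q : ℝ × LGConfig 4 G => T q.1 q.2) ∧
      (∀ (t : ℝ) (U : LGConfig 4 G),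
        Function.update U e (((combTransport U e.1)⁻¹ * k t * combTransport U e.1)⁻¹ * U e) = T (-t) U) := by
  refine ⟨fun t U => Function.update U e ((combTransport U e.1)⁻¹ * k t * combTransport U e.1 * U e), fun t U => rfl,
    fun U => ?_, fun s t U => ?_, ?_, fun t U => ?_⟩
  · dsimp only
    rw [oneParam_zero hk, mul_one, inv_mul_cancel, one_mul, Function.update_eq_self]
  · dsimp only
    rw [hinv, Function.update_self, Function.update_idem, oneParam_add hk]
    congr 1
    group
  · refine continuous_snd.update e ?_
    have hG : Continuous fun q : ℝ × LGConfig 4 G => combTransport q.2 e.1 :=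
      (TangentPlaqFieldContinuous.continuous_combTransport e.1).comp continuous_snd
    exact ((hG.inv.mul ((continuous_oneParam hk).comp continuous_fst)).mul hG).mul
      ((continuous_apply e).comp continuous_snd)
  · dsimp only
    rw [oneParam_neg hk]
    congr 1
    group

/-- **The right family** `T_t U = U[e ↦ U_e G_U(x')⁻¹ k(t)⁻¹ G_U(x')]` (`x' = e.1 + e_i`): the same
properties, the flow property as soon as `G_U(x')` does not read the link `e`. -/
theorem rightFamily (hk : ∀ t : ℝ, r.ρ (k t) = NormedSpace.exp ((t : ℂ) • lieVec r b))
    (e : Literature.MathematicalPhysics.QuantumLattice.ZdEdge 4)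
    (hinv : ∀ (U : LGConfig 4 G) (g : G),
      combTransport (Function.update U e g) (e.1 + Pi.single e.2 1) = combTransport U (e.1 + Pi.single e.2 1)) :
    ∃ T : ℝ → LGConfig 4 G → LGConfig 4 G,
      (∀ (t : ℝ) (U : LGConfig 4 G), T t U = Function.update U e (U e * ((combTransport U (e.1 + Pi.single e.2 1))⁻¹ * (k t)⁻¹ *
        combTransport U (e.1 + Pi.single e.2 1)))) ∧
      (∀ U, T 0 U = U) ∧ (∀ s t U, T (t + s) U = T t (T s U)) ∧ (Continuous fun q : ℝ × LGConfig 4 G => T q.1 q.2) ∧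
      (∀ (t : ℝ) (U : LGConfig 4 G),
        Function.update U e (U e * ((combTransport U (e.1 + Pi.single e.2 1))⁻¹ * (k t)⁻¹ *
          combTransport U (e.1 + Pi.single e.2 1))⁻¹) = T (-t) U) := by
  refine ⟨fun t U => Function.update U e (U e * ((combTransport U (e.1 + Pi.single e.2 1))⁻¹ * (k t)⁻¹ *
      combTransport U (e.1 + Pi.single e.2 1))), fun t U => rfl, fun U => ?_, fun s t U => ?_, ?_, fun t U => ?_⟩
  · dsimp only
    rw [oneParam_zero hk, inv_one, mul_one, inv_mul_cancel, mul_one, Function.update_eq_self]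
  · dsimp only
    rw [hinv, Function.update_self, Function.update_idem, oneParam_add hk]
    congr 1
    group
  · refine continuous_snd.update e ?_
    have hG : Continuous fun q : ℝ × LGConfig 4 G => combTransport q.2 (e.1 + Pi.single e.2 1) :=
      (TangentPlaqFieldContinuous.continuous_combTransport _).comp continuous_snd
    exact ((continuous_apply e).comp continuous_snd).mul
      ((hG.inv.mul ((continuous_oneParam hk).comp continuous_fst).inv).mul hG)
  · dsimp only
    rw [oneParam_neg hk, inv_inv]
    congr 1
    group

omit [CompactSpace G] in
/-- The conjugated shift element `U ↦ G_U(y)⁻¹ c G_U(y)` is a continuous cylinder function. -/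
theorem cylinder_conj (y : Site 4) (c : G) :
    ∃ Sγ : Finset (Literature.MathematicalPhysics.QuantumLattice.ZdEdge 4),
      IsCylinder (fun U : LGConfig 4 G => (combTransport U y)⁻¹ * c * combTransport U y) Sγ ∧
      Continuous (fun U : LGConfig 4 G => (combTransport U y)⁻¹ * c * combTransport U y) := by
  classical
  refine ⟨(Fintype.piFinset fun _ : Fin 4 => Finset.Icc (-(∑ i, |y i|)) (∑ i, |y i|)) ×ˢ Finset.univ, ?_, ?_⟩
  · intro U U' hUU'
    have hUU : ∀ (z : Site 4) (l : Fin 4), (∀ j, |z j| ≤ ∑ i, |y i|) → U (z, l) = U' (z, l) := fun z l hz =>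
      hUU' (z, l) (Finset.mem_product.2
        ⟨Fintype.mem_piFinset.2 fun j => Finset.mem_Icc.2 (abs_le.1 (hz j)), Finset.mem_univ _⟩)
    dsimp only
    rw [TangentPlaqFieldContinuous.combTransport_congr_of_box hUU y fun j =>
      Finset.single_le_sum (fun i _ => abs_nonneg (y i)) (Finset.mem_univ j)]
  · have hG := TangentPlaqFieldContinuous.continuous_combTransport (G := G) y
    exact (hG.inv.mul continuous_const).mul hG


omit [CompactSpace G] in
/-- The test observable `U ↦ Fn(∑_{p ∈ S} ∑_a h_p^a Y_p^a(U))` is a continuous cylinder observable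
bounded by `1` (for `|Fn| ≤ 1`). -/
theorem cylinder_test (r : LatticeRep G) (β : ℝ) (S : Finset (ZdPlaquette 4))
    (h : ZdPlaquette 4 → Fin (lieDim r) → ℝ) (Fn : ℝ → ℝ) (hFnc : Continuous Fn) (hFb : ∀ x, |Fn x| ≤ 1) :
    ∃ SF : Finset (Literature.MathematicalPhysics.QuantumLattice.ZdEdge 4),
      IsCylinder (fun U : LGConfig 4 G => Fn (∑ p ∈ S, ∑ a, h p a * plaqField r β U p a)) SF ∧
      Continuous (fun U : LGConfig 4 G => Fn (∑ p ∈ S, ∑ a, h p a * plaqField r β U p a)) ∧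
      ∀ U : LGConfig 4 G, |Fn (∑ p ∈ S, ∑ a, h p a * plaqField r β U p a)| ≤ 1 := by
  classical
  refine ⟨S.biUnion fun p => (Fintype.piFinset fun _ : Fin 4 => Finset.Icc (-(2 + ∑ i, |p.1 i|)) (2 + ∑ i, |p.1 i|)) ×ˢ
    Finset.univ, ?_, ?_, fun U => hFb _⟩
  · intro U U' hUU'
    refine congrArg Fn (Finset.sum_congr rfl fun p hp => Finset.sum_congr rfl fun a _ => ?_)
    have hc := TangentPlaqFieldContinuous.isCylinder_plaqField r β p a (2 + ∑ i, |p.1 i|)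
      (TangentPlaqFieldContinuous.abs_add_two_le_sum p.1) (fun e he => hUU' e (Finset.mem_biUnion.2 ⟨p, hp, he⟩))
    dsimp only at hc
    rw [hc]
  · exact hFnc.comp (continuous_finsetSum _ fun p _ => continuous_finsetSum _ fun a _ =>
      continuous_const.mul (TangentPlaqFieldContinuous.continuous_plaqField_apply r β p a))

end Families

end TangentSteinFiniteBeta

/-- Registered helper stub `stub_steinPrelim` of line `Sketch` (crux `stmt-QuantumFields-8760`): the statement of
`TangentSteinFiniteBeta.leftFamily` (see its docstring), fully qualified. -/
theorem stub_steinPrelim :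
    ∀ {G : Type} [Group G] [TopologicalSpace G] [IsTopologicalGroup G] [CompactSpace G] {r : Literature.MathematicalPhysics.QuantumFieldTheory.LatticeRep G} {b : Fin (Summit.QuantumFields.YangMills.Theorems.EquipartitionPinsProbe.lieDim r)} {k : ℝ → G} (hk : ∀ t : ℝ, r.ρ (k t) = NormedSpace.exp ((t : ℂ) • Summit.QuantumFields.YangMills.Theorems.EquipartitionPinsProbe.lieVec r b))
    (e : Literature.MathematicalPhysics.QuantumLattice.ZdEdge 4)
    (hinv : ∀ (U : Literature.MathematicalPhysics.QuantumLattice.LGConfig 4 G) (g : G), Summit.QuantumFields.YangMills.Theorems.EquipartitionPinsProbe.combTransport (Function.update U e g) e.1 = Summit.QuantumFields.YangMills.Theorems.EquipartitionPinsProbe.combTransport U e.1),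
      ∃ T : ℝ → Literature.MathematicalPhysics.QuantumLattice.LGConfig 4 G → Literature.MathematicalPhysics.QuantumLattice.LGConfig 4 G,
      (∀ (t : ℝ) (U : Literature.MathematicalPhysics.QuantumLattice.LGConfig 4 G), T t U = Function.update U e ((Summit.QuantumFields.YangMills.Theorems.EquipartitionPinsProbe.combTransport U e.1)⁻¹ * k t * Summit.QuantumFields.YangMills.Theorems.EquipartitionPinsProbe.combTransport U e.1 * U e)) ∧
      (∀ U, T 0 U = U) ∧ (∀ s t U, T (t + s) U = T t (T s U)) ∧ (Continuous fun q : ℝ × Literature.MathematicalPhysics.QuantumLattice.LGConfig 4 G => T q.1 q.2) ∧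
      (∀ (t : ℝ) (U : Literature.MathematicalPhysics.QuantumLattice.LGConfig 4 G),
        Function.update U e (((Summit.QuantumFields.YangMills.Theorems.EquipartitionPinsProbe.combTransport U e.1)⁻¹ * k t * Summit.QuantumFields.YangMills.Theorems.EquipartitionPinsProbe.combTransport U e.1)⁻¹ * U e) = T (-t) U) :=
  @TangentSteinFiniteBeta.leftFamily

end Summit.QuantumFields.YangMills.Theorems.EquipartitionPinsProbe

end
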